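import Literature.NumberTheory.LFunctions.KloostermanIncompleteSplit
import Literature.NumberTheory.LFunctions.KloostermanFractionsAmplifier
import Literature.NumberTheory.LFunctions.GcdSumBounds
import HarnessLib

/-!
# Bilinear forms with Kloosterman fractions: the diagonal terms `ℓ₁n₁ = ℓ₂n₂` (Bettin–Chandee §3)

Topic `NumberTheory/LFunctions`.  S. Bettin, V. Chandee, *Trilinear forms with Kloosterman
fractions*, Adv. Math. 328 (2018), §3 "The diagonal terms" (refining W. Duke, J. Friedlander,
H. Iwaniec, Invent. Math. 128 (1997), where these terms are bounded trivially), specialised to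
`A = 1` (no average over `a`; their `ϑ` is our `k`).  After the amplification of
`KloostermanFractionsAmplifier.lean` / `KloostermanFractionsAmplifiedForm.lean` one must bound
`𝓓_b = ∑_{m ∼ M, (m,b)=1} ∑_{ℓ₁,ℓ₂ ∈ 𝓛, n₁,n₂, ℓ₁n₁ = ℓ₂n₂, (m, ℓ₂n₂) = 1} c_m(n₁) conj c_m(n₂)`,
`c_m(n) = γ_n e(k m̄/(bn))` (`m̄` the inverse of `m` modulo `bn`), `𝓛` a set of primes in
`(L, 2L]` coprime to `k`, `γ` supported on `n ∼ N'` coprime to `k`, `(k, b) = 1`.  The source: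
"By symmetry and the inequality `2|ab| ≤ a² + b²`, we see that the diagonal terms are bounded by
`∑ |β_{n₁}|² |∑_{m, (m, bℓ₁ℓ₂n₁n₂)=1} e(ϑ(a₁ℓ₁ - a₂ℓ₂) m̄/(bℓ₁n₁))|`.  For the terms satisfying
`a₁ℓ₁ ≠ a₂ℓ₂` we use the version of Weil's bound given in Lemma (ks) … `≪ (bLN)^{1/2+ε} +
(a₁ℓ₁ - a₂ℓ₂, bn₁ℓ₁) M^{1+ε}/(bLN)` … since `∑_{ℓ₁,ℓ₂, ℓ₂ ∣ ℓ₁n₁} (a₁ℓ₁ - a₂ℓ₂, bn) ≪ AL²M^ε`.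
The contribution of the terms with `a₁ℓ₁ = a₂ℓ₂` is trivially `O(‖β‖² L^{1+ε} M)`, and thus
`𝓓_b ≪ ‖β‖²‖ν‖² L (A(bLN)^{1/2} + AM/(bN) + M) M^ε`" [(eqn:diagonal)].

This file PROVES that bound with `A = 1` and explicit constants (`kfd_diag_bound`): for `b ≥ 1`,
`(k, b) = 1`, `L ≥ 2`, `𝓛 ⊆ {primes in (L, 2L] not dividing k}`, `γ_n ≠ 0 ⇒ N' < n, (n,k) = 1,
τ(bn) ≤ T`, and `M₁ ≤ M₂`,

  `‖∑_{M₁<m≤M₂, (m,b)=1} ∑_{ℓ₁n₁=ℓ₂n₂, …} c_m(n₁) conj c_m(n₂)‖`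
  `≤ ‖γ‖² ( #𝓛 (M₂ - M₁) + (log(2N')/log L) (4T(M₂ - M₁)/(bN') + 16 T² L (bLN')^{1/2} (1 + log(4bLN'))) )`

(so `≪ ‖γ‖² (LM + M/(bN') + L(bLN')^{1/2}) (MN')^ε`; the source's middle term carries an extra
`L`).  The left side is literally `‖∑_m kfDiag k b N' γ 𝓛 m‖` of
`KloostermanFractionsAmplifiedForm.lean` with the definitions unfolded: the phase is a section
variable `e` pinned down by the hypothesis `he : ∀ k q m, e k q m = exp(2πi k m̄^{(q)}/q)`
(instantiate with `kfPhase` and `fun _ _ _ => rfl`).  Steps, following the source: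

* `kfd_phase_combine` — on the diagonal `ℓ₁n₁ = ℓ₂n₂ = N₀`, for `(m, bN₀) = 1`:
  `e(k m̄^{(bn₁)}/(bn₁)) conj e(k m̄^{(bn₂)}/(bn₂)) = e(k(ℓ₁ - ℓ₂) m̄^{(bN₀)}/(bN₀))`;
* `kfd_msum_le` — the `m`-sum is an incomplete Kloosterman sum to modulus `s = bN₀`:
  `‖∑_{M₁<m≤M₂,(m,s)=1} e(a m̄/s)‖ ≤ ((M₂-M₁)/s)(a,s) + τ(s) s^{1/2} (a,s)^{1/2} (1 + log s)`
  (`KI_sum_progression_le`, i.e. Bettin–Chandee App. Lemma 1 = DFI Lemma 8, with `q = 1`);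
* `kfd_diag_norm_le_weighted` — interchange, the symmetrisation `2|γ_{n₁}γ_{n₂}| ≤ |γ_{n₁}|² +
  |γ_{n₂}|²` (`kfd_symmetrize`), and "`n₂` is determined by `ℓ₁, n₁, ℓ₂`";
* `kfd_K1b_le`, `kfd_sum_gcd_primes_le`, `kfd_inner_primes_le` — for `ℓ₁ ≠ ℓ₂`: `ℓ₂ ∣ n₁` (at
  most `log(2N')/log L` such `ℓ₂`, `DFI_card_primes_dvd_mul_log_le`), `(k(ℓ₁-ℓ₂), bℓ₁n₁) =
  (|ℓ₁-ℓ₂|, bℓ₁n₁) ≤ (|ℓ₁-ℓ₂|, bn₁)`, `τ(bℓ₁n₁) ≤ 2τ(bn₁)`, `bLN' < bℓ₁n₁ ≤ 4bLN'`, and the gcd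
  sum `∑_{ℓ₁ ≠ ℓ₂} (|ℓ₁-ℓ₂|, bn₁) ≤ 4Lτ(bn₁)`; the terms `ℓ₁ = ℓ₂` contribute `#𝓛 (M₂-M₁)`.

## References

* S. Bettin, V. Chandee, Adv. Math. 328 (2018) 1234–1262 (arXiv:1502.00769), §3 and Appendix
  Lemma 1. [BettinChandee2018]
* W. Duke, J. Friedlander, H. Iwaniec, *Bilinear forms with Kloosterman fractions*, Invent. Math.
  128 (1997) 23–43, §3 and Lemma 8. [DukeFriedlanderIwaniec1997]
-/

noncomputable section

open Finset

namespace Literature.NumberTheory.LFunctions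

section Phase

/- Throughout, `e k q m` stands for the Kloosterman-fraction phase `e(k m̄^{(q)}/q)`, i.e. the body
of `kfPhase k q m` of `KloostermanFractionsAmplifiedForm.lean`; it is a section variable pinned
down by the hypothesis `he` (instantiate with `kfPhase` and `fun _ _ _ => rfl`). -/
variable (e : ℤ → ℕ → ℕ → ℂ)
  (he : ∀ (k : ℤ) (q m : ℕ), e k q m = Complex.exp (2 * Real.pi * Complex.I *
    ((k : ℂ) * ((((m : ZMod q)⁻¹).val : ℕ) : ℂ) / (q : ℂ))))

/-! ### Phase algebra -/

include he in
/-- `conj e(k x̄/q) = e((-k) x̄/q)`. [folklore] -/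
theorem kfd_conj_e (k : ℤ) (q m : ℕ) :
    (starRingEnd ℂ) (e k q m) = e (-k) q m := by
  rw [he, he, ← Complex.exp_conj]
  congr 1
  simp only [map_mul, map_div₀, map_ofNat, Complex.conj_ofReal, Complex.conj_I, map_intCast,
    map_natCast]
  push_cast
  ring

include he in
/-- `‖e(k x̄/q)‖ = 1`. [folklore] -/
theorem kfd_norm_e (k : ℤ) (q m : ℕ) : ‖e k q m‖ = 1 := by
  have h : 2 * (Real.pi : ℂ) * Complex.I *
      ((k : ℂ) * ((((m : ZMod q)⁻¹).val : ℕ) : ℂ) / (q : ℂ)) =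
      (((2 * Real.pi * ((k : ℝ) * ((((m : ZMod q)⁻¹).val : ℕ) : ℝ) / (q : ℝ)) : ℝ)) : ℂ) *
        Complex.I := by
    push_cast; ring
  rw [he, h, Complex.norm_exp_ofReal_mul_I]

include he in
/-- **Combining the two phases on the diagonal**: for `ℓ₁n₁ = ℓ₂n₂ = N₀` and `(m, bN₀) = 1`,
`e(k m̄^{(bn₁)}/(bn₁)) · conj e(k m̄^{(bn₂)}/(bn₂)) = e(k(ℓ₁ - ℓ₂) m̄^{(bN₀)}/(bN₀))`.
[cite: BettinChandee2018, §3, second display] -/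
theorem kfd_phase_combine (k : ℤ) {b ℓ₁ n₁ ℓ₂ n₂ m : ℕ} (hb : 0 < b) (hℓ₁ : 0 < ℓ₁) (hn₁ : 0 < n₁)
    (hn₂ : 0 < n₂) (hN : ℓ₁ * n₁ = ℓ₂ * n₂) (hm : m.Coprime (b * (ℓ₁ * n₁))) :
    e k (b * n₁) m * (starRingEnd ℂ) (e k (b * n₂) m) =
      e (k * ((ℓ₁ : ℤ) - ℓ₂)) (b * (ℓ₁ * n₁)) m := by
  have hs₂ : b * (ℓ₁ * n₁) = b * (ℓ₂ * n₂) := by rw [hN]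
  haveI : NeZero (b * (ℓ₁ * n₁)) := ⟨(Nat.mul_pos hb (Nat.mul_pos hℓ₁ hn₁)).ne'⟩
  haveI : NeZero (b * n₁) := ⟨(Nat.mul_pos hb hn₁).ne'⟩
  haveI : NeZero (b * n₂) := ⟨(Nat.mul_pos hb hn₂).ne'⟩
  have hd₁ : b * n₁ ∣ b * (ℓ₁ * n₁) := ⟨ℓ₁, by ring⟩
  have hd₂ : b * n₂ ∣ b * (ℓ₁ * n₁) := ⟨ℓ₂, by rw [hs₂]; ring⟩
  have h1 : ((m : ZMod (b * n₁))⁻¹).val = ((m : ZMod (b * (ℓ₁ * n₁)))⁻¹).val % (b * n₁) :=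
    (KI_inv_val_mod_nat hd₁ hm).symm
  have h2 : ((m : ZMod (b * n₂))⁻¹).val = ((m : ZMod (b * (ℓ₁ * n₁)))⁻¹).val % (b * n₂) :=
    (KI_inv_val_mod_nat hd₂ hm).symm
  rw [kfd_conj_e e he]
  simp only [he]
  rw [h1, h2, ← KI_e_mod k (Nat.mul_pos hb hn₁),
    ← KI_e_mod (-k) (Nat.mul_pos hb hn₂), ← Complex.exp_add]
  congr 1
  set u : ℕ := ((m : ZMod (b * (ℓ₁ * n₁)))⁻¹).val with hu
  have hℓ₂ : 0 < ℓ₂ := Nat.pos_of_ne_zero (by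
    rintro rfl; rw [zero_mul] at hN; exact (Nat.mul_pos hℓ₁ hn₁).ne' hN)
  have hb0 : (b : ℂ) ≠ 0 := by exact_mod_cast hb.ne'
  have hℓ₁0 : (ℓ₁ : ℂ) ≠ 0 := by exact_mod_cast hℓ₁.ne'
  have hℓ₂0 : (ℓ₂ : ℂ) ≠ 0 := by exact_mod_cast hℓ₂.ne'
  have hn₁0 : (n₁ : ℂ) ≠ 0 := by exact_mod_cast hn₁.ne'
  have hn₂0 : (n₂ : ℂ) ≠ 0 := by exact_mod_cast hn₂.ne'
  have e1 : ((b * n₁ : ℕ) : ℂ)⁻¹ = (ℓ₁ : ℂ) / ((b * (ℓ₁ * n₁) : ℕ) : ℂ) := by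
    push_cast; field_simp
  have e2 : ((b * n₂ : ℕ) : ℂ)⁻¹ = (ℓ₂ : ℂ) / ((b * (ℓ₁ * n₁) : ℕ) : ℂ) := by
    rw [hs₂]; push_cast; field_simp
  simp only [div_eq_mul_inv]
  rw [e1, e2]
  push_cast
  ring

/-! ### The sum over `m` (incomplete Kloosterman sum to modulus `bN₀`) -/

include he in
/-- **The `m`-sum on the diagonal** (Bettin–Chandee App. Lemma 1 = DFI Lemma 8, via
`KI_sum_progression_le` with `q = 1`): for `s ≥ 1`, `a ∈ ℤ`, `M₁ ≤ M₂`,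
`‖∑_{M₁ < m ≤ M₂, (m,s)=1} e(a m̄/s)‖ ≤ ((M₂ - M₁)/s)(a,s) + τ(s) √s √(a,s) (1 + log s)`.
[cite: BettinChandee2018, Appendix Lemma 1] -/
theorem kfd_msum_le {s : ℕ} (hs : 0 < s) (a : ℤ) {M₁ M₂ : ℕ} (hM : M₁ ≤ M₂) :
    ‖∑ m ∈ (Ioc M₁ M₂).filter (fun m => m.Coprime s), e a s m‖ ≤
      ((M₂ : ℝ) - M₁) / s * Int.gcd a s +
        (Nat.divisors s).card * Real.sqrt s * Real.sqrt (Int.gcd a s) * (1 + Real.log s) := by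
  have h := KI_sum_progression_le hs (q := 1) (Nat.coprime_one_left s) a 0 (M₁ : ℤ) (M₂ : ℤ)
    (by exact_mod_cast hM)
  simp only [Nat.cast_one, zero_add, one_mul] at h
  have hsum : ∑ y ∈ (Finset.Ioc (M₁ : ℤ) M₂).filter (fun y : ℤ => Int.gcd y s = 1),
        Complex.exp (2 * Real.pi * Complex.I *
          ((a : ℂ) * (((((y : ℤ) : ZMod s)⁻¹).val : ℕ) : ℂ) / (s : ℂ))) =
      ∑ m ∈ (Ioc M₁ M₂).filter (fun m => m.Coprime s), e a s m := by
    refine Finset.sum_nbij' (fun y => y.toNat) (fun m => (m : ℤ)) ?_ ?_ ?_ ?_ ?_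
    · intro y hy
      simp only [Finset.mem_filter, Finset.mem_Ioc] at hy ⊢
      obtain ⟨⟨h1, h2⟩, h3⟩ := hy
      have hy0 : 0 ≤ y := by omega
      refine ⟨⟨by omega, by omega⟩, ?_⟩
      have : Int.gcd ((y.toNat : ℕ) : ℤ) (s : ℤ) = 1 := by rwa [Int.toNat_of_nonneg hy0]
      rwa [Int.gcd_natCast_natCast] at this
    · intro m hm
      simp only [Finset.mem_filter, Finset.mem_Ioc] at hm ⊢
      refine ⟨⟨by exact_mod_cast hm.1.1, by exact_mod_cast hm.1.2⟩, ?_⟩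
      rw [Int.gcd_natCast_natCast]
      exact hm.2
    · intro y hy
      simp only [Finset.mem_filter, Finset.mem_Ioc] at hy
      exact Int.toNat_of_nonneg (by omega)
    · intro m _
      exact Int.toNat_natCast m
    · intro y hy
      simp only [Finset.mem_filter, Finset.mem_Ioc] at hy
      have hy0 : 0 ≤ y := by omega
      have hcast : ((y : ℤ) : ZMod s) = ((y.toNat : ℕ) : ZMod s) := by
        rw [← Int.cast_natCast (R := ZMod s), Int.toNat_of_nonneg hy0]
      rw [he, hcast]
  rw [hsum] at h
  have hlen : (((M₂ : ℤ) - (M₁ : ℤ) : ℤ) : ℝ) = (M₂ : ℝ) - M₁ := by push_cast; ring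
  rw [hlen] at h
  exact h

include he in
/-- The trivial bound `‖∑_{m ∈ S'} e(·) conj e(·)‖ ≤ #S'`. [folklore] -/
theorem kfd_msum_trivial (k : ℤ) (q₁ q₂ : ℕ) (S' : Finset ℕ) :
    ‖∑ m ∈ S', e k q₁ m * (starRingEnd ℂ) (e k q₂ m)‖ ≤ S'.card := by
  have h := norm_sum_le S' (fun m => e k q₁ m * (starRingEnd ℂ) (e k q₂ m))
  refine h.trans ?_
  have : ∀ m ∈ S', ‖e k q₁ m * (starRingEnd ℂ) (e k q₂ m)‖ ≤ 1 := by
    intro m _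
    rw [norm_mul, RCLike.norm_conj, kfd_norm_e e he, kfd_norm_e e he, mul_one]
  calc ∑ m ∈ S', ‖e k q₁ m * (starRingEnd ℂ) (e k q₂ m)‖ ≤ ∑ m ∈ S', (1 : ℝ) :=
        Finset.sum_le_sum this
    _ = S'.card := by simp


/-! ### The bound `Φ` for the `m`-sum attached to a diagonal quadruple -/

section Phi

/- `Φ k b M₁ M₂ ℓ₁ ℓ₂ N₀`: the trivial bound `M₂ - M₁` if `ℓ₁ = ℓ₂`, else the completion bound of
`kfd_msum_le` for modulus `s = bN₀` and frequency `a = k(ℓ₁ - ℓ₂)`; a section variable pinned down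
by `hΦ`. -/
variable (Φ : ℤ → ℕ → ℕ → ℕ → ℕ → ℕ → ℕ → ℝ)
  (hΦ : ∀ (k : ℤ) (b M₁ M₂ ℓ₁ ℓ₂ N₀ : ℕ), Φ k b M₁ M₂ ℓ₁ ℓ₂ N₀ =
    if ℓ₁ = ℓ₂ then ((M₂ : ℝ) - (M₁ : ℝ)) else
      (((M₂ : ℝ) - (M₁ : ℝ)) / ((b * N₀ : ℕ) : ℝ) *
          (Int.gcd (k * ((ℓ₁ : ℤ) - (ℓ₂ : ℤ))) ((b * N₀ : ℕ) : ℤ) : ℝ) +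
        ((Nat.divisors (b * N₀)).card : ℝ) * Real.sqrt ((b * N₀ : ℕ) : ℝ) *
          Real.sqrt (Int.gcd (k * ((ℓ₁ : ℤ) - (ℓ₂ : ℤ))) ((b * N₀ : ℕ) : ℤ) : ℝ) *
          (1 + Real.log ((b * N₀ : ℕ) : ℝ))))

include hΦ in
/-- `Φ ≥ 0` (for `M₁ ≤ M₂`). [folklore] -/
theorem kfd_Phi_nonneg (k : ℤ) (b M₁ M₂ ℓ₁ ℓ₂ N₀ : ℕ) (hM : M₁ ≤ M₂) (hs : 0 < b * N₀) :
    0 ≤ Φ k b M₁ M₂ ℓ₁ ℓ₂ N₀ := by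
  rw [hΦ]
  have hlen : (0 : ℝ) ≤ (M₂ : ℝ) - M₁ := by
    have : (M₁ : ℝ) ≤ M₂ := by exact_mod_cast hM
    linarith
  have hlog : 0 ≤ 1 + Real.log (((b * N₀ : ℕ)) : ℝ) := by
    have : (1 : ℝ) ≤ ((b * N₀ : ℕ) : ℝ) := by exact_mod_cast hs
    have := Real.log_nonneg this
    linarith
  split_ifs
  · exact hlen
  · positivity

include hΦ in
/-- `Φ` is symmetric in `ℓ₁, ℓ₂` (as `(−a, s) = (a, s)`). [folklore] -/
theorem kfd_Phi_symm (k : ℤ) (b M₁ M₂ ℓ₁ ℓ₂ N₀ : ℕ) :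
    Φ k b M₁ M₂ ℓ₂ ℓ₁ N₀ = Φ k b M₁ M₂ ℓ₁ ℓ₂ N₀ := by
  rw [hΦ, hΦ]
  have hg : Int.gcd (k * ((ℓ₂ : ℤ) - (ℓ₁ : ℤ))) ((b * N₀ : ℕ) : ℤ) =
      Int.gcd (k * ((ℓ₁ : ℤ) - (ℓ₂ : ℤ))) ((b * N₀ : ℕ) : ℤ) := by
    rw [show k * ((ℓ₂ : ℤ) - (ℓ₁ : ℤ)) = -(k * ((ℓ₁ : ℤ) - (ℓ₂ : ℤ))) by ring, Int.neg_gcd]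
  by_cases h : ℓ₁ = ℓ₂
  · subst h; rfl
  · rw [if_neg (Ne.symm h), if_neg h, hg]

include he hΦ in
/-- **The `m`-sum of a diagonal quadruple**: for `ℓ₁n₁ = ℓ₂n₂`, `b ≥ 1`, `M₁ ≤ M₂`,
`‖∑_{M₁<m≤M₂, (m,b)=1, (m,ℓ₂n₂)=1} e(k m̄/(bn₁)) conj e(k m̄/(bn₂))‖ ≤ Φ`: the trivial bound when
`ℓ₁ = ℓ₂`, the completed Weil bound (modulus `bℓ₁n₁`, frequency `k(ℓ₁-ℓ₂)`) otherwise.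
[cite: BettinChandee2018, §3] -/
theorem kfd_W_le (k : ℤ) {b ℓ₁ n₁ ℓ₂ n₂ : ℕ} (hb : 0 < b) (hℓ₁ : 0 < ℓ₁) (hn₁ : 0 < n₁)
    (hn₂ : 0 < n₂) (hN : ℓ₁ * n₁ = ℓ₂ * n₂) {M₁ M₂ : ℕ} (hM : M₁ ≤ M₂) :
    ‖∑ m ∈ ((Ioc M₁ M₂).filter (fun m => m.Coprime b)).filter (fun m => (ℓ₂ * n₂).Coprime m),
        e k (b * n₁) m * (starRingEnd ℂ) (e k (b * n₂) m)‖ ≤ Φ k b M₁ M₂ ℓ₁ ℓ₂ (ℓ₁ * n₁) := by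
  -- the summation condition is `(m, b ℓ₁ n₁) = 1`
  have hset : ((Ioc M₁ M₂).filter (fun m => m.Coprime b)).filter (fun m => (ℓ₂ * n₂).Coprime m) =
      (Ioc M₁ M₂).filter (fun m => m.Coprime (b * (ℓ₁ * n₁))) := by
    rw [Finset.filter_filter]
    refine Finset.filter_congr fun m _ => ?_
    rw [hN]
    constructor
    · rintro ⟨h1, h2⟩
      exact Nat.Coprime.mul_right h1 h2.symm
    · intro h
      exact ⟨Nat.Coprime.coprime_mul_right_right h,
        (Nat.Coprime.coprime_mul_left_right h).symm⟩
  rw [hset, hΦ]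
  by_cases hℓ : ℓ₁ = ℓ₂
  · -- trivial bound
    rw [if_pos hℓ]
    refine (kfd_msum_trivial e he k (b * n₁) (b * n₂) _).trans ?_
    calc (((Ioc M₁ M₂).filter (fun m => m.Coprime (b * (ℓ₁ * n₁)))).card : ℝ)
        ≤ ((Ioc M₁ M₂).card : ℝ) := by exact_mod_cast Finset.card_filter_le _ _
      _ = (M₂ : ℝ) - M₁ := by
        rw [Nat.card_Ioc]; push_cast [Nat.cast_sub hM]; ring
  · rw [if_neg hℓ]
    have hsum : ∑ m ∈ (Ioc M₁ M₂).filter (fun m => m.Coprime (b * (ℓ₁ * n₁))),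
        e k (b * n₁) m * (starRingEnd ℂ) (e k (b * n₂) m) =
        ∑ m ∈ (Ioc M₁ M₂).filter (fun m => m.Coprime (b * (ℓ₁ * n₁))),
          e (k * ((ℓ₁ : ℤ) - ℓ₂)) (b * (ℓ₁ * n₁)) m := by
      refine Finset.sum_congr rfl fun m hm => ?_
      exact kfd_phase_combine e he k hb hℓ₁ hn₁ hn₂ hN (Finset.mem_filter.mp hm).2
    rw [hsum]
    exact kfd_msum_le e he (Nat.mul_pos hb (Nat.mul_pos hℓ₁ hn₁)) _ hM

/-! ### Rearrangement: the sum over `m` inside, the diagonal quadruples outside -/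

/-- Moving the `m`-sum inside four other sums. [folklore] -/
theorem kfd_sum_comm5 (S 𝓛 I : Finset ℕ) (F : ℕ → ℕ → ℕ → ℕ → ℕ → ℂ) :
    ∑ m ∈ S, ∑ ℓ₁ ∈ 𝓛, ∑ n₁ ∈ I, ∑ ℓ₂ ∈ 𝓛, ∑ n₂ ∈ I, F m ℓ₁ n₁ ℓ₂ n₂ =
      ∑ ℓ₁ ∈ 𝓛, ∑ n₁ ∈ I, ∑ ℓ₂ ∈ 𝓛, ∑ n₂ ∈ I, ∑ m ∈ S, F m ℓ₁ n₁ ℓ₂ n₂ := by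
  rw [Finset.sum_comm]
  refine Finset.sum_congr rfl fun ℓ₁ _ => ?_
  rw [Finset.sum_comm]
  refine Finset.sum_congr rfl fun n₁ _ => ?_
  rw [Finset.sum_comm]
  refine Finset.sum_congr rfl fun ℓ₂ _ => ?_
  rw [Finset.sum_comm]

/-- On a diagonal quadruple the congruence condition is automatic and the `m`-sum factors:
`∑_m [cond] c_m(n₁) conj c_m(n₂) = γ_{n₁} conj γ_{n₂} · ∑_{m, (ℓ₂n₂,m)=1} e(…) conj e(…)`.
[cite: BettinChandee2018, §3] -/
theorem kfd_inner_msum_eq (k : ℤ) (b : ℕ) (γ : ℕ → ℂ) (S : Finset ℕ) {ℓ₁ n₁ ℓ₂ n₂ : ℕ}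
    (hN : ℓ₁ * n₁ = ℓ₂ * n₂) :
    ∑ m ∈ S, (if (ℓ₂ * n₂).Coprime m ∧ ((ℓ₁ * n₁ : ℕ) : ZMod m) = ((ℓ₂ * n₂ : ℕ) : ZMod m) then
        γ n₁ * e k (b * n₁) m * (starRingEnd ℂ) (γ n₂ * e k (b * n₂) m) else 0) =
      γ n₁ * (starRingEnd ℂ) (γ n₂) *
        ∑ m ∈ S.filter (fun m => (ℓ₂ * n₂).Coprime m),
          e k (b * n₁) m * (starRingEnd ℂ) (e k (b * n₂) m) := by
  rw [Finset.sum_filter, Finset.mul_sum]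
  refine Finset.sum_congr rfl fun m _ => ?_
  rw [hN]
  by_cases h : (ℓ₂ * n₂).Coprime m
  · rw [if_pos ⟨h, rfl⟩, if_pos h, map_mul]; ring
  · rw [if_neg (fun hc => h hc.1), if_neg h, mul_zero]

include he hΦ in
/-- **Norm of the `m`-sum of a diagonal quadruple**: `≤ ‖γ_{n₁}‖ ‖γ_{n₂}‖ Φ`.
[cite: BettinChandee2018, §3] -/
theorem kfd_inner_msum_norm_le (k : ℤ) {b : ℕ} (hb : 0 < b) (γ : ℕ → ℂ) {M₁ M₂ : ℕ}
    (hM : M₁ ≤ M₂) {ℓ₁ n₁ ℓ₂ n₂ : ℕ} (hℓ₁ : 0 < ℓ₁) (hn₁ : 0 < n₁) (hn₂ : 0 < n₂)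
    (hN : ℓ₁ * n₁ = ℓ₂ * n₂) :
    ‖∑ m ∈ (Ioc M₁ M₂).filter (fun m => m.Coprime b),
        (if (ℓ₂ * n₂).Coprime m ∧ ((ℓ₁ * n₁ : ℕ) : ZMod m) = ((ℓ₂ * n₂ : ℕ) : ZMod m) then
          γ n₁ * e k (b * n₁) m * (starRingEnd ℂ) (γ n₂ * e k (b * n₂) m) else 0)‖ ≤
      ‖γ n₁‖ * ‖γ n₂‖ * Φ k b M₁ M₂ ℓ₁ ℓ₂ (ℓ₁ * n₁) := by
  rw [kfd_inner_msum_eq e k b γ _ hN, norm_mul, norm_mul, RCLike.norm_conj]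
  exact mul_le_mul_of_nonneg_left (kfd_W_le e he Φ hΦ k hb hℓ₁ hn₁ hn₂ hN hM) (by positivity)

/-! ### Symmetrisation `2|γ_{n₁} γ_{n₂}| ≤ |γ_{n₁}|² + |γ_{n₂}|²` -/

/-- Abstract symmetrisation: for a symmetric relation `P` and a weight `F ≥ 0` symmetric on `P`,
`∑∑_{P x y} g_x g_y F(x,y) ≤ ∑∑_{P x y} g_x² F(x,y)` (`g ≥ 0`). [folklore] -/
theorem kfd_symmetrize {ι : Type*} (A : Finset ι) (P : ι → ι → Prop) [DecidableRel P]
    (hP : ∀ x ∈ A, ∀ y ∈ A, P x y → P y x) (g : ι → ℝ) (F : ι → ι → ℝ)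
    (hF : ∀ x ∈ A, ∀ y ∈ A, P x y → F y x = F x y) (hF0 : ∀ x ∈ A, ∀ y ∈ A, 0 ≤ F x y) :
    ∑ x ∈ A, ∑ y ∈ A, (if P x y then g x * g y * F x y else 0) ≤
      ∑ x ∈ A, ∑ y ∈ A, (if P x y then g x ^ 2 * F x y else 0) := by
  -- the `g_y²`-weighted sum equals the `g_x²`-weighted one
  have hswap : ∑ x ∈ A, ∑ y ∈ A, (if P x y then g y ^ 2 * F x y else 0) =
      ∑ x ∈ A, ∑ y ∈ A, (if P x y then g x ^ 2 * F x y else 0) := by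
    rw [Finset.sum_comm]
    refine Finset.sum_congr rfl fun x hx => Finset.sum_congr rfl fun y hy => ?_
    by_cases hxy : P x y
    · have hyx : P y x := hP x hx y hy hxy
      rw [if_pos hyx, if_pos hxy, hF x hx y hy hxy]
    · have hyx : ¬ P y x := fun h => hxy (hP y hy x hx h)
      rw [if_neg hyx, if_neg hxy]
  have hpt : ∀ x ∈ A, ∀ y ∈ A, (if P x y then g x * g y * F x y else 0) ≤
      ((if P x y then g x ^ 2 * F x y else 0) + (if P x y then g y ^ 2 * F x y else 0)) / 2 := by
    intro x hx y hy
    split_ifs with hxy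
    · have h2 : 2 * (g x * g y) ≤ g x ^ 2 + g y ^ 2 := by nlinarith [sq_nonneg (g x - g y)]
      have hF' := hF0 x hx y hy
      nlinarith
    · simp
  calc ∑ x ∈ A, ∑ y ∈ A, (if P x y then g x * g y * F x y else 0)
      ≤ ∑ x ∈ A, ∑ y ∈ A,
          ((if P x y then g x ^ 2 * F x y else 0) + (if P x y then g y ^ 2 * F x y else 0)) / 2 :=
        Finset.sum_le_sum fun x hx => Finset.sum_le_sum fun y hy => hpt x hx y hy
    _ = (∑ x ∈ A, ∑ y ∈ A, (if P x y then g x ^ 2 * F x y else 0) +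
          ∑ x ∈ A, ∑ y ∈ A, (if P x y then g y ^ 2 * F x y else 0)) / 2 := by
        rw [← Finset.sum_add_distrib, Finset.sum_div]
        refine Finset.sum_congr rfl fun x _ => ?_
        rw [← Finset.sum_add_distrib, Finset.sum_div]
    _ = ∑ x ∈ A, ∑ y ∈ A, (if P x y then g x ^ 2 * F x y else 0) := by
        rw [hswap]; ring


/-- The symmetrisation for the diagonal quadruples `ℓ₁n₁ = ℓ₂n₂` in nested form.
[cite: BettinChandee2018, §3, "by symmetry and the inequality 2|ab| ≤ a² + b²"] -/
theorem kfd_symmetrize_nested (𝓛 I : Finset ℕ) (g : ℕ → ℝ) (F : ℕ → ℕ → ℕ → ℝ)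
    (hFsymm : ∀ ℓ₁ ℓ₂ N₀, F ℓ₂ ℓ₁ N₀ = F ℓ₁ ℓ₂ N₀)
    (hF0 : ∀ ℓ₁ ∈ 𝓛, ∀ n₁ ∈ I, ∀ ℓ₂, 0 ≤ F ℓ₁ ℓ₂ (ℓ₁ * n₁)) :
    ∑ ℓ₁ ∈ 𝓛, ∑ n₁ ∈ I, ∑ ℓ₂ ∈ 𝓛, ∑ n₂ ∈ I,
        (if ℓ₁ * n₁ = ℓ₂ * n₂ then g n₁ * g n₂ * F ℓ₁ ℓ₂ (ℓ₁ * n₁) else 0) ≤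
      ∑ ℓ₁ ∈ 𝓛, ∑ n₁ ∈ I, ∑ ℓ₂ ∈ 𝓛, ∑ n₂ ∈ I,
        (if ℓ₁ * n₁ = ℓ₂ * n₂ then g n₁ ^ 2 * F ℓ₁ ℓ₂ (ℓ₁ * n₁) else 0) := by
  have h := kfd_symmetrize (𝓛 ×ˢ I) (fun x y => x.1 * x.2 = y.1 * y.2)
    (fun x _ y _ hxy => hxy.symm) (fun x => g x.2) (fun x y => F x.1 y.1 (x.1 * x.2))
    (fun x _ y _ hxy => by
      show F y.1 x.1 (y.1 * y.2) = F x.1 y.1 (x.1 * x.2)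
      rw [← hxy, hFsymm])
    (fun x hx y _ => by
      rw [Finset.mem_product] at hx
      exact hF0 x.1 hx.1 x.2 hx.2 y.1)
  simpa only [Finset.sum_product] using h

/-- At most one `n₂` with `N₀ = ℓ₂ n₂`, and none unless `ℓ₂ ∣ N₀` (`N₀ ≠ 0`). [folklore] -/
theorem kfd_card_filter_eq_mul_le (I : Finset ℕ) {N₀ : ℕ} (hN₀ : N₀ ≠ 0) (ℓ₂ : ℕ) :
    ((I.filter (fun n₂ => N₀ = ℓ₂ * n₂)).card : ℝ) ≤ if ℓ₂ ∣ N₀ then 1 else 0 := by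
  by_cases hd : ℓ₂ ∣ N₀
  · rw [if_pos hd]
    have hℓ₂ : 0 < ℓ₂ := Nat.pos_of_ne_zero (by rintro rfl; exact hN₀ (Nat.eq_zero_of_zero_dvd hd))
    have : (I.filter (fun n₂ => N₀ = ℓ₂ * n₂)).card ≤ 1 := by
      refine Finset.card_le_one.mpr fun a ha c hc => ?_
      have ha' := (Finset.mem_filter.mp ha).2
      have hc' := (Finset.mem_filter.mp hc).2
      exact Nat.eq_of_mul_eq_mul_left hℓ₂ (ha'.symm.trans hc')
    exact_mod_cast this
  · rw [if_neg hd]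
    have : (I.filter (fun n₂ => N₀ = ℓ₂ * n₂)).card = 0 := by
      rw [Finset.card_eq_zero, Finset.filter_eq_empty_iff]
      intro n₂ _ h
      exact hd ⟨n₂, h⟩
    rw [this]; simp

/-- Collapsing the `n₂`-sum: `∑_{n₂} [N₀ = ℓ₂n₂] c ≤ [ℓ₂ ∣ N₀] c` for `c ≥ 0`, `N₀ ≠ 0`.
[folklore] -/
theorem kfd_sum_n₂_le (I : Finset ℕ) {N₀ : ℕ} (hN₀ : N₀ ≠ 0) (ℓ₂ : ℕ) {c : ℝ} (hc : 0 ≤ c) :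
    ∑ n₂ ∈ I, (if N₀ = ℓ₂ * n₂ then c else 0) ≤ if ℓ₂ ∣ N₀ then c else 0 := by
  rw [← Finset.sum_filter, Finset.sum_const, nsmul_eq_mul]
  have h := kfd_card_filter_eq_mul_le I hN₀ ℓ₂
  calc ((I.filter (fun n₂ => N₀ = ℓ₂ * n₂)).card : ℝ) * c ≤ (if ℓ₂ ∣ N₀ then 1 else 0) * c :=
        mul_le_mul_of_nonneg_right h hc
    _ = if ℓ₂ ∣ N₀ then c else 0 := by split_ifs <;> simp

include he hΦ in
/-- **The diagonal, reduced to a weighted count** (Bettin–Chandee §3, first two displays, with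
the `m`-sums estimated): for `b ≥ 1`, `M₁ ≤ M₂`, `𝓛 ⊆ ℕ_{>0}`,
`‖∑_{m} ∑_{ℓ₁n₁=ℓ₂n₂} [cond] c_m(n₁) conj c_m(n₂)‖ ≤ ∑_{ℓ₁,n₁} ‖γ_{n₁}‖² ∑_{ℓ₂ ∣ ℓ₁n₁} Φ(ℓ₁,ℓ₂,ℓ₁n₁)`.
[cite: BettinChandee2018, §3] -/
theorem kfd_diag_norm_le_weighted (k : ℤ) {b : ℕ} (hb : 0 < b) (γ : ℕ → ℂ) (𝓛 : Finset ℕ)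
    (h𝓛 : ∀ ℓ ∈ 𝓛, 0 < ℓ) (I : Finset ℕ) (hI : ∀ n ∈ I, 0 < n) {M₁ M₂ : ℕ} (hM : M₁ ≤ M₂) :
    ‖∑ m ∈ (Ioc M₁ M₂).filter (fun m => m.Coprime b),
        ∑ ℓ₁ ∈ 𝓛, ∑ n₁ ∈ I, ∑ ℓ₂ ∈ 𝓛, ∑ n₂ ∈ I,
          (if ℓ₁ * n₁ = ℓ₂ * n₂ then
            (if (ℓ₂ * n₂).Coprime m ∧ ((ℓ₁ * n₁ : ℕ) : ZMod m) = ((ℓ₂ * n₂ : ℕ) : ZMod m) then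
              γ n₁ * e k (b * n₁) m * (starRingEnd ℂ) (γ n₂ * e k (b * n₂) m) else 0)
          else 0)‖ ≤
      ∑ ℓ₁ ∈ 𝓛, ∑ n₁ ∈ I, ‖γ n₁‖ ^ 2 *
        ∑ ℓ₂ ∈ 𝓛, (if ℓ₂ ∣ ℓ₁ * n₁ then Φ k b M₁ M₂ ℓ₁ ℓ₂ (ℓ₁ * n₁) else 0) := by
  rw [kfd_sum_comm5]
  -- (1) pointwise bound for the `m`-sums
  have h1 : ‖∑ ℓ₁ ∈ 𝓛, ∑ n₁ ∈ I, ∑ ℓ₂ ∈ 𝓛, ∑ n₂ ∈ I,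
      ∑ m ∈ (Ioc M₁ M₂).filter (fun m => m.Coprime b),
        (if ℓ₁ * n₁ = ℓ₂ * n₂ then
          (if (ℓ₂ * n₂).Coprime m ∧ ((ℓ₁ * n₁ : ℕ) : ZMod m) = ((ℓ₂ * n₂ : ℕ) : ZMod m) then
            γ n₁ * e k (b * n₁) m * (starRingEnd ℂ) (γ n₂ * e k (b * n₂) m) else 0)
        else 0)‖ ≤
      ∑ ℓ₁ ∈ 𝓛, ∑ n₁ ∈ I, ∑ ℓ₂ ∈ 𝓛, ∑ n₂ ∈ I,
        (if ℓ₁ * n₁ = ℓ₂ * n₂ then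
          ‖γ n₁‖ * ‖γ n₂‖ * Φ k b M₁ M₂ ℓ₁ ℓ₂ (ℓ₁ * n₁) else 0) := by
    refine (norm_sum_le _ _).trans (Finset.sum_le_sum fun ℓ₁ hℓ₁ => ?_)
    refine (norm_sum_le _ _).trans (Finset.sum_le_sum fun n₁ hn₁ => ?_)
    refine (norm_sum_le _ _).trans (Finset.sum_le_sum fun ℓ₂ _ => ?_)
    refine (norm_sum_le _ _).trans (Finset.sum_le_sum fun n₂ hn₂ => ?_)
    rw [Finset.sum_ite_irrel]
    by_cases hdiag : ℓ₁ * n₁ = ℓ₂ * n₂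
    · rw [if_pos hdiag, if_pos hdiag]
      exact kfd_inner_msum_norm_le e he Φ hΦ k hb γ hM (h𝓛 ℓ₁ hℓ₁) (hI n₁ hn₁) (hI n₂ hn₂)
        hdiag
    · rw [if_neg hdiag, if_neg hdiag]
      simp
  -- (2) symmetrisation
  have h2 := kfd_symmetrize_nested 𝓛 I (fun n => ‖γ n‖)
    (fun ℓ₁ ℓ₂ N₀ => Φ k b M₁ M₂ ℓ₁ ℓ₂ N₀)
    (fun ℓ₁ ℓ₂ N₀ => kfd_Phi_symm Φ hΦ k b M₁ M₂ ℓ₁ ℓ₂ N₀)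
    (fun ℓ₁ hℓ₁ n₁ hn₁ ℓ₂ => kfd_Phi_nonneg Φ hΦ k b M₁ M₂ ℓ₁ ℓ₂ (ℓ₁ * n₁) hM
      (Nat.mul_pos hb (Nat.mul_pos (h𝓛 ℓ₁ hℓ₁) (hI n₁ hn₁))))
  refine h1.trans (h2.trans ?_)
  -- (3) collapse the `n₂`-sum
  refine Finset.sum_le_sum fun ℓ₁ hℓ₁ => Finset.sum_le_sum fun n₁ hn₁ => ?_
  rw [Finset.mul_sum]
  refine Finset.sum_le_sum fun ℓ₂ _ => ?_
  have hN₀ : ℓ₁ * n₁ ≠ 0 := (Nat.mul_pos (h𝓛 ℓ₁ hℓ₁) (hI n₁ hn₁)).ne'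
  have hc : 0 ≤ ‖γ n₁‖ ^ 2 * Φ k b M₁ M₂ ℓ₁ ℓ₂ (ℓ₁ * n₁) :=
    mul_nonneg (sq_nonneg _) (kfd_Phi_nonneg Φ hΦ k b M₁ M₂ ℓ₁ ℓ₂ (ℓ₁ * n₁) hM
      (Nat.mul_pos hb (Nat.pos_of_ne_zero hN₀)))
  refine (kfd_sum_n₂_le I hN₀ ℓ₂ hc).trans (le_of_eq ?_)
  split_ifs <;> simp


/-! ### Arithmetic of the prime amplifier on the diagonal -/

/-- **The gcd sum over the amplifier primes**: for `𝓛 ⊆ [1, 2L]`, `ℓ₂ ∈ [1, 2L]`, `q ≠ 0`,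
`∑_{ℓ₁ ∈ 𝓛, ℓ₁ ≠ ℓ₂} (|ℓ₁ - ℓ₂|, q) ≤ 4 L τ(q)` (the map `ℓ₁ ↦ |ℓ₁ - ℓ₂| ∈ [1, 2L]` is at most
two-to-one). [cite: BettinChandee2018, §3, last display] -/
theorem kfd_sum_gcd_primes_le {L : ℕ} (𝓛 : Finset ℕ) (h𝓛 : ∀ ℓ ∈ 𝓛, 1 ≤ ℓ ∧ ℓ ≤ 2 * L) {ℓ₂ : ℕ}
    (hℓ₂ : 1 ≤ ℓ₂ ∧ ℓ₂ ≤ 2 * L) {q : ℕ} (hq : q ≠ 0) :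
    ∑ ℓ₁ ∈ 𝓛.filter (fun ℓ₁ : ℕ => ℓ₁ ≠ ℓ₂), (Nat.gcd (Int.natAbs ((ℓ₁ : ℤ) - ℓ₂)) q : ℝ) ≤
      4 * L * q.divisors.card := by
  classical
  set s := 𝓛.filter (fun ℓ₁ : ℕ => ℓ₁ ≠ ℓ₂) with hs
  have hcomp := Finset.sum_comp (s := s) (fun d : ℕ => (Nat.gcd d q : ℝ))
    (fun ℓ₁ : ℕ => Int.natAbs ((ℓ₁ : ℤ) - ℓ₂))
  rw [hcomp]
  -- each fibre has at most two elements
  have hfib : ∀ d : ℕ,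
      ((s.filter (fun ℓ₁ : ℕ => Int.natAbs ((ℓ₁ : ℤ) - ℓ₂) = d)).card : ℝ) ≤ 2 := by
    intro d
    have hsub : s.filter (fun ℓ₁ : ℕ => Int.natAbs ((ℓ₁ : ℤ) - ℓ₂) = d) ⊆
        ({ℓ₂ + d, ℓ₂ - d} : Finset ℕ) := by
      intro ℓ₁ hℓ₁
      rw [Finset.mem_filter] at hℓ₁
      rw [Finset.mem_insert, Finset.mem_singleton]
      rcases Int.natAbs_eq_iff.mp hℓ₁.2 with h | h <;> omega
    have := Finset.card_le_card hsub
    have h2 : (({ℓ₂ + d, ℓ₂ - d} : Finset ℕ)).card ≤ 2 := Finset.card_le_two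
    exact_mod_cast this.trans h2
  -- the image lies in `[1, 2L]`
  have himg : s.image (fun ℓ₁ : ℕ => Int.natAbs ((ℓ₁ : ℤ) - ℓ₂)) ⊆ Icc 1 (2 * L) := by
    intro d hd
    rw [Finset.mem_image] at hd
    obtain ⟨ℓ₁, hℓ₁, rfl⟩ := hd
    rw [hs, Finset.mem_filter] at hℓ₁
    have h1 := h𝓛 ℓ₁ hℓ₁.1
    rw [Finset.mem_Icc]
    omega
  calc ∑ d ∈ s.image (fun ℓ₁ : ℕ => Int.natAbs ((ℓ₁ : ℤ) - ℓ₂)),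
        (s.filter (fun ℓ₁ : ℕ => Int.natAbs ((ℓ₁ : ℤ) - ℓ₂) = d)).card • (Nat.gcd d q : ℝ)
      ≤ ∑ d ∈ s.image (fun ℓ₁ : ℕ => Int.natAbs ((ℓ₁ : ℤ) - ℓ₂)), 2 * (Nat.gcd d q : ℝ) := by
        refine Finset.sum_le_sum fun d _ => ?_
        rw [nsmul_eq_mul]
        exact mul_le_mul_of_nonneg_right (hfib d) (Nat.cast_nonneg _)
    _ ≤ ∑ d ∈ Icc 1 (2 * L), 2 * (Nat.gcd d q : ℝ) :=
        Finset.sum_le_sum_of_subset_of_nonneg himg fun _ _ _ => by positivity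
    _ = 2 * ∑ d ∈ Icc 1 (2 * L), (Nat.gcd d q : ℝ) := by rw [Finset.mul_sum]
    _ ≤ 2 * ((q.divisors.card : ℝ) * (2 * L : ℕ)) :=
        mul_le_mul_of_nonneg_left (MatomakiMerikoski.MatomakiMerikoski2023_lemma37_i hq (2 * L))
          (by norm_num)
    _ = 4 * L * q.divisors.card := by push_cast; ring

/-- **The completion bound on the diagonal, simplified** (Bettin–Chandee §3, third display with
`A = 1`): for distinct primes `ℓ₁, ℓ₂ ∈ (L, 2L]` coprime to `k`, `N' < n₁ ≤ 2N'` with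
`(n₁, k) = 1`, `(k, b) = 1` and `τ(bn₁) ≤ T`,
`((M₂-M₁)/(bℓ₁n₁)) (k(ℓ₁-ℓ₂), bℓ₁n₁) + τ(bℓ₁n₁) (bℓ₁n₁)^{1/2} (k(ℓ₁-ℓ₂), bℓ₁n₁)^{1/2} (1 + log(bℓ₁n₁))`
`≤ (|ℓ₁-ℓ₂|, bn₁) · ((M₂-M₁)/(bLN') + 4T (bLN')^{1/2} (1 + log(4bLN')))`.
[cite: BettinChandee2018, §3] -/
theorem kfd_K1b_le (k : ℤ) {b L : ℕ} (hb : 0 < b) (hL : 1 ≤ L) (hkb : k.natAbs.Coprime b)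
    {ℓ₁ ℓ₂ n₁ : ℕ} (hp₁ : ℓ₁.Prime) (hp₂ : ℓ₂.Prime) (hne : ℓ₁ ≠ ℓ₂) (hℓ₁L : L < ℓ₁)
    (hℓ₁L' : ℓ₁ ≤ 2 * L) (hℓ₁k : ℓ₁.Coprime k.natAbs) {N' T : ℝ} (hN' : 0 < N')
    (hn₁N : N' < n₁) (hn₁2 : (n₁ : ℝ) ≤ 2 * N') (hn₁k : n₁.Coprime k.natAbs)
    (hT : ((b * n₁).divisors.card : ℝ) ≤ T) {M₁ M₂ : ℕ} (hM : M₁ ≤ M₂) :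
    ((M₂ : ℝ) - (M₁ : ℝ)) / (((b : ℕ) * (ℓ₁ * n₁ : ℕ) : ℕ) : ℝ) *
        (Int.gcd ((k : ℤ) * (((ℓ₁ : ℕ) : ℤ) - ((ℓ₂ : ℕ) : ℤ))) (((b : ℕ) * (ℓ₁ * n₁ : ℕ) : ℕ) : ℤ) : ℝ) +
      ((Nat.divisors ((b : ℕ) * (ℓ₁ * n₁ : ℕ))).card : ℝ) *
        Real.sqrt (((b : ℕ) * (ℓ₁ * n₁ : ℕ) : ℕ) : ℝ) *
        Real.sqrt (Int.gcd ((k : ℤ) * (((ℓ₁ : ℕ) : ℤ) - ((ℓ₂ : ℕ) : ℤ)))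
          (((b : ℕ) * (ℓ₁ * n₁ : ℕ) : ℕ) : ℤ) : ℝ) *
        (1 + Real.log (((b : ℕ) * (ℓ₁ * n₁ : ℕ) : ℕ) : ℝ)) ≤
      (Nat.gcd (Int.natAbs ((ℓ₁ : ℤ) - ℓ₂)) (b * n₁) : ℝ) *
        (((M₂ : ℝ) - M₁) / (b * L * N') +
          4 * T * Real.sqrt (b * L * N') * (1 + Real.log (4 * (b * L * N')))) := by
  -- notation
  set s : ℕ := b * (ℓ₁ * n₁) with hs
  set d : ℕ := Int.natAbs ((ℓ₁ : ℤ) - ℓ₂) with hd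
  set g' : ℕ := Nat.gcd d (b * n₁) with hg'
  have hn₁pos : 0 < n₁ := by
    have : (0 : ℝ) < n₁ := hN'.trans hn₁N
    exact_mod_cast this
  have hℓ₁pos : 0 < ℓ₁ := hp₁.pos
  have hspos : 0 < s := Nat.mul_pos hb (Nat.mul_pos hℓ₁pos hn₁pos)
  have hbn₁ : 0 < b * n₁ := Nat.mul_pos hb hn₁pos
  have hg'pos : 0 < g' := Nat.gcd_pos_of_pos_right _ hbn₁
  -- the gcd: `(k(ℓ₁-ℓ₂), bℓ₁n₁) = (|ℓ₁-ℓ₂|, bℓ₁n₁) ≤ (|ℓ₁-ℓ₂|, bn₁) = g'`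
  have hcop : k.natAbs.Coprime s := by
    rw [hs]
    exact Nat.Coprime.mul_right hkb (Nat.Coprime.mul_right hℓ₁k.symm hn₁k.symm)
  have hgcd_eq : Int.gcd (k * ((ℓ₁ : ℤ) - (ℓ₂ : ℤ))) (s : ℤ) = Nat.gcd d s := by
    rw [Int.gcd_eq_natAbs, Int.natAbs_mul, Int.natAbs_natCast]
    exact Nat.Coprime.gcd_mul_left_cancel d hcop
  have hdℓ₁ : Nat.Coprime d ℓ₁ := by
    rw [Nat.coprime_comm, Nat.Prime.coprime_iff_not_dvd hp₁]
    intro h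
    have h1 : (ℓ₁ : ℤ) ∣ (ℓ₁ : ℤ) - ℓ₂ := Int.ofNat_dvd_left.mpr h
    have h2 : (ℓ₁ : ℤ) ∣ (ℓ₂ : ℤ) := by
      have := dvd_sub (dvd_refl (ℓ₁ : ℤ)) h1
      simpa using this
    have h3 : ℓ₁ ∣ ℓ₂ := Int.natCast_dvd_natCast.mp h2
    exact hne ((Nat.prime_dvd_prime_iff_eq hp₁ hp₂).mp h3)
  have hgcd_le : Nat.gcd d s ≤ g' := by
    have hs' : s = ℓ₁ * (b * n₁) := by rw [hs]; ring
    rw [hs', hg', Nat.Coprime.gcd_mul_left_cancel_right (b * n₁) hdℓ₁.symm]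
  have hg_le : (Int.gcd (k * ((ℓ₁ : ℤ) - (ℓ₂ : ℤ))) (s : ℤ) : ℝ) ≤ g' := by
    rw [hgcd_eq]; exact_mod_cast hgcd_le
  have hg'1 : (1 : ℝ) ≤ g' := by exact_mod_cast hg'pos
  -- sizes: `bLN' ≤ s ≤ 4bLN'`
  have hL0 : (0 : ℝ) < L := by exact_mod_cast hL
  have hb0 : (0 : ℝ) < b := by exact_mod_cast hb
  have hX : (0 : ℝ) < b * L * N' := by positivity
  have hs_ge : (b : ℝ) * L * N' ≤ (s : ℝ) := by
    rw [hs]; push_cast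
    have h1 : (L : ℝ) ≤ ℓ₁ := by exact_mod_cast hℓ₁L.le
    have h2 : N' ≤ n₁ := hn₁N.le
    calc (b : ℝ) * L * N' = b * (L * N') := by ring
      _ ≤ b * (ℓ₁ * n₁) := by gcongr
  have hs_le : (s : ℝ) ≤ 4 * (b * L * N') := by
    rw [hs]; push_cast
    have h1 : (ℓ₁ : ℝ) ≤ 2 * L := by exact_mod_cast hℓ₁L'
    calc (b : ℝ) * (ℓ₁ * n₁) ≤ b * ((2 * L) * (2 * N')) := by gcongr
      _ = 4 * (b * L * N') := by ring
  have hs1 : (1 : ℝ) ≤ s := by exact_mod_cast hspos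
  -- the four factors
  have hlen : (0 : ℝ) ≤ (M₂ : ℝ) - M₁ := by
    have : (M₁ : ℝ) ≤ M₂ := by exact_mod_cast hM
    linarith
  have hA : ((M₂ : ℝ) - M₁) / (s : ℝ) ≤ ((M₂ : ℝ) - M₁) / (b * L * N') :=
    div_le_div_of_nonneg_left hlen hX hs_ge
  have hτ : ((Nat.divisors s).card : ℝ) ≤ 2 * T := by
    have h1 : (Nat.divisors s).card ≤ ℓ₁.divisors.card * (b * n₁).divisors.card := by
      rw [hs, show b * (ℓ₁ * n₁) = ℓ₁ * (b * n₁) by ring, Nat.divisors_mul]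
      exact Finset.card_mul_le
    rw [Nat.Prime.divisors hp₁, Finset.card_pair hp₁.one_lt.ne] at h1
    calc ((Nat.divisors s).card : ℝ) ≤ ((2 * (b * n₁).divisors.card : ℕ) : ℝ) := by
          exact_mod_cast h1
      _ = 2 * ((b * n₁).divisors.card : ℝ) := by push_cast; ring
      _ ≤ 2 * T := by linarith
  have hsqrt_s : Real.sqrt (s : ℝ) ≤ 2 * Real.sqrt (b * L * N') := by
    calc Real.sqrt (s : ℝ) ≤ Real.sqrt (4 * (b * L * N')) := Real.sqrt_le_sqrt hs_le
      _ = Real.sqrt 4 * Real.sqrt (b * L * N') := Real.sqrt_mul (by norm_num) _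
      _ = 2 * Real.sqrt (b * L * N') := by
        rw [show (4 : ℝ) = 2 ^ 2 by norm_num, Real.sqrt_sq (by norm_num)]
  have hsqrt_g : Real.sqrt (Int.gcd (k * ((ℓ₁ : ℤ) - (ℓ₂ : ℤ))) (s : ℤ) : ℝ) ≤ g' := by
    calc Real.sqrt (Int.gcd (k * ((ℓ₁ : ℤ) - (ℓ₂ : ℤ))) (s : ℤ) : ℝ) ≤ Real.sqrt g' :=
          Real.sqrt_le_sqrt hg_le
      _ ≤ g' := Real.sqrt_le_iff.mpr ⟨by positivity, by nlinarith⟩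
  have hlog : 1 + Real.log (s : ℝ) ≤ 1 + Real.log (4 * (b * L * N')) := by
    have := Real.log_le_log (by positivity) hs_le
    linarith
  have hlog0 : 0 ≤ 1 + Real.log (s : ℝ) := by
    have := Real.log_nonneg hs1; linarith
  have hT0 : 0 ≤ T := le_trans (Nat.cast_nonneg _) hT
  -- assemble
  have hsC : (((b : ℕ) * (ℓ₁ * n₁ : ℕ) : ℕ) : ℝ) = (s : ℝ) := by rw [hs]
  have hsZ : (((b : ℕ) * (ℓ₁ * n₁ : ℕ) : ℕ) : ℤ) = (s : ℤ) := by rw [hs]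
  rw [hsC, hsZ]
  set G : ℝ := (Int.gcd (k * ((ℓ₁ : ℤ) - (ℓ₂ : ℤ))) (s : ℤ) : ℝ) with hG
  have hG0 : 0 ≤ G := Nat.cast_nonneg _
  calc ((M₂ : ℝ) - M₁) / (s : ℝ) * G +
        ((Nat.divisors s).card : ℝ) * Real.sqrt (s : ℝ) * Real.sqrt G * (1 + Real.log (s : ℝ))
      ≤ ((M₂ : ℝ) - M₁) / (b * L * N') * g' +
        (2 * T) * (2 * Real.sqrt (b * L * N')) * g' * (1 + Real.log (4 * (b * L * N'))) := by
        gcongr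
    _ = (g' : ℝ) * (((M₂ : ℝ) - M₁) / (b * L * N') +
          4 * T * Real.sqrt (b * L * N') * (1 + Real.log (4 * (b * L * N')))) := by ring


include hΦ in
/-- **The diagonal count for a fixed `n₁`** (Bettin–Chandee §3 with `A = 1`): for the amplifier
primes `𝓛 ⊆ (L, 2L]` coprime to `k`, `(k, b) = 1`, `N' < n₁ ≤ 2N'`, `(n₁, k) = 1`, `τ(bn₁) ≤ T`:
`∑_{ℓ₁, ℓ₂ ∈ 𝓛, ℓ₂ ∣ ℓ₁n₁} Φ(ℓ₁, ℓ₂, ℓ₁n₁) ≤ #𝓛 (M₂ - M₁)`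
`+ (log(2N')/log L) (4T (M₂-M₁)/(bN') + 16 T² L (bLN')^{1/2} (1 + log(4bLN')))`
(the terms `ℓ₁ = ℓ₂` trivially; for `ℓ₁ ≠ ℓ₂` one has `ℓ₂ ∣ n₁`, at most `log(2N')/log L`
choices, and the gcd sum over `ℓ₁`). [cite: BettinChandee2018, §3, (eqn:diagonal)] -/
theorem kfd_inner_primes_le (k : ℤ) {b L : ℕ} (hb : 0 < b) (hL : 2 ≤ L) (hkb : k.natAbs.Coprime b)
    (𝓛 : Finset ℕ) (h𝓛 : ∀ ℓ ∈ 𝓛, ℓ.Prime ∧ L < ℓ ∧ ℓ ≤ 2 * L ∧ ℓ.Coprime k.natAbs)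
    {N' T : ℝ} (hN' : 0 < N') {n₁ : ℕ} (hn₁N : N' < n₁) (hn₁2 : (n₁ : ℝ) ≤ 2 * N')
    (hn₁k : n₁.Coprime k.natAbs) (hT : ((b * n₁).divisors.card : ℝ) ≤ T) {M₁ M₂ : ℕ}
    (hM : M₁ ≤ M₂) :
    ∑ ℓ₁ ∈ 𝓛, ∑ ℓ₂ ∈ 𝓛, (if ℓ₂ ∣ ℓ₁ * n₁ then Φ k b M₁ M₂ ℓ₁ ℓ₂ (ℓ₁ * n₁) else 0) ≤
      𝓛.card * ((M₂ : ℝ) - M₁) + Real.log (2 * N') / Real.log L *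
        (4 * T * ((M₂ : ℝ) - M₁) / (b * N') +
          16 * T ^ 2 * L * Real.sqrt (b * L * N') * (1 + Real.log (4 * (b * L * N')))) := by
  classical
  -- notation and signs
  set len : ℝ := (M₂ : ℝ) - M₁ with hlen
  set E : ℝ := len / (b * L * N') +
    4 * T * Real.sqrt (b * L * N') * (1 + Real.log (4 * (b * L * N'))) with hE
  have hL1 : 1 ≤ L := le_trans (by norm_num) hL
  have hL0 : (0 : ℝ) < L := by exact_mod_cast (lt_of_lt_of_le (by norm_num) hL : 0 < L)
  have hb0 : (0 : ℝ) < b := by exact_mod_cast hb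
  have hX : (0 : ℝ) < b * L * N' := by positivity
  have hlen0 : 0 ≤ len := by
    have : (M₁ : ℝ) ≤ M₂ := by exact_mod_cast hM
    rw [hlen]; linarith
  have hT0 : 0 ≤ T := le_trans (Nat.cast_nonneg _) hT
  have hn₁pos : 0 < n₁ := by
    have : (0 : ℝ) < n₁ := hN'.trans hn₁N
    exact_mod_cast this
  have hbn₁ : b * n₁ ≠ 0 := (Nat.mul_pos hb hn₁pos).ne'
  have hX1 : (1 : ℝ) ≤ 4 * (b * L * N') := by
    have h1 : (1 : ℝ) ≤ b := by exact_mod_cast hb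
    have h2 : (1 : ℝ) ≤ L := by exact_mod_cast hL1
    have h3 : (1 : ℝ) ≤ n₁ := by exact_mod_cast hn₁pos
    have h4 : (1 : ℝ) / 2 ≤ N' := by linarith
    calc (1 : ℝ) ≤ 4 * (1 * 1 * (1 / 2)) := by norm_num
      _ ≤ 4 * (b * L * N') := by gcongr
  have hlog4 : 0 ≤ 1 + Real.log (4 * (b * L * N')) := by
    have := Real.log_nonneg hX1; linarith
  have hE0 : 0 ≤ E := by rw [hE]; positivity
  -- the summand and its off-diagonal majorant
  set X : ℕ → ℕ → ℝ := fun ℓ₁ ℓ₂ =>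
    if ℓ₂ ∣ ℓ₁ * n₁ then Φ k b M₁ M₂ ℓ₁ ℓ₂ (ℓ₁ * n₁) else 0 with hXdef
  set Y : ℕ → ℕ → ℝ := fun ℓ₁ ℓ₂ =>
    if ℓ₂ ∣ n₁ then (Nat.gcd (Int.natAbs ((ℓ₁ : ℤ) - ℓ₂)) (b * n₁) : ℝ) * E else 0 with hYdef
  have hY0 : ∀ ℓ₁ ℓ₂, 0 ≤ Y ℓ₁ ℓ₂ := fun ℓ₁ ℓ₂ => by
    simp only [hYdef]; split_ifs <;> positivity
  -- Step 1: the terms `ℓ₂ = ℓ₁` contribute `len` each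
  have hsplit : ∀ ℓ₁ ∈ 𝓛, ∑ ℓ₂ ∈ 𝓛, X ℓ₁ ℓ₂ =
      len + ∑ ℓ₂ ∈ 𝓛.filter (fun ℓ₂ => ℓ₂ ≠ ℓ₁), X ℓ₁ ℓ₂ := by
    intro ℓ₁ hℓ₁
    rw [← Finset.sum_filter_add_sum_filter_not 𝓛 (fun ℓ₂ => ℓ₂ = ℓ₁), Finset.filter_eq',
      if_pos hℓ₁, Finset.sum_singleton]
    congr 1
    simp only [hXdef]
    rw [if_pos (Dvd.intro n₁ rfl), hΦ, if_pos rfl]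
  -- Step 2: off the diagonal, `X ≤ Y`
  have hXY : ∀ ℓ₁ ∈ 𝓛, ∀ ℓ₂ ∈ 𝓛.filter (fun ℓ₂ => ℓ₂ ≠ ℓ₁), X ℓ₁ ℓ₂ ≤ Y ℓ₁ ℓ₂ := by
    intro ℓ₁ hℓ₁ ℓ₂ hℓ₂
    rw [Finset.mem_filter] at hℓ₂
    obtain ⟨hp₁, hℓ₁L, hℓ₁L', hℓ₁k⟩ := h𝓛 ℓ₁ hℓ₁
    obtain ⟨hp₂, -, -, -⟩ := h𝓛 ℓ₂ hℓ₂.1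
    have hne : ℓ₁ ≠ ℓ₂ := fun h => hℓ₂.2 h.symm
    simp only [hXdef, hYdef]
    by_cases hd : ℓ₂ ∣ ℓ₁ * n₁
    · have hd' : ℓ₂ ∣ n₁ := by
        rcases (Nat.Prime.dvd_mul hp₂).mp hd with h | h
        · exact absurd ((Nat.prime_dvd_prime_iff_eq hp₂ hp₁).mp h).symm hne
        · exact h
      rw [if_pos hd, if_pos hd', hΦ, if_neg hne]
      exact kfd_K1b_le k hb hL1 hkb hp₁ hp₂ hne hℓ₁L hℓ₁L' hℓ₁k hN' hn₁N hn₁2 hn₁k hT hM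
    · rw [if_neg hd]
      split_ifs <;> positivity
  -- Step 3: the double sum of `Y`
  have h𝓛' : ∀ ℓ ∈ 𝓛, 1 ≤ ℓ ∧ ℓ ≤ 2 * L := fun ℓ hℓ =>
    ⟨(h𝓛 ℓ hℓ).1.one_lt.le, (h𝓛 ℓ hℓ).2.2.1⟩
  have hYsum : ∑ ℓ₁ ∈ 𝓛, ∑ ℓ₂ ∈ 𝓛.filter (fun ℓ₂ => ℓ₂ ≠ ℓ₁), Y ℓ₁ ℓ₂ ≤
      (4 * L * (b * n₁).divisors.card * E) * ((𝓛.filter (fun ℓ => ℓ ∣ n₁)).card : ℝ) := by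
    have hswap : ∑ ℓ₁ ∈ 𝓛, ∑ ℓ₂ ∈ 𝓛.filter (fun ℓ₂ => ℓ₂ ≠ ℓ₁), Y ℓ₁ ℓ₂ =
        ∑ ℓ₂ ∈ 𝓛, ∑ ℓ₁ ∈ 𝓛, (if ℓ₂ ≠ ℓ₁ then Y ℓ₁ ℓ₂ else 0) := by
      rw [Finset.sum_comm]
      refine Finset.sum_congr rfl fun ℓ₂ _ => ?_
      rw [Finset.sum_filter]
    rw [hswap]
    have hinner : ∀ ℓ₂ ∈ 𝓛, ∑ ℓ₁ ∈ 𝓛, (if ℓ₂ ≠ ℓ₁ then Y ℓ₁ ℓ₂ else 0) ≤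
        if ℓ₂ ∣ n₁ then 4 * L * (b * n₁).divisors.card * E else 0 := by
      intro ℓ₂ hℓ₂
      by_cases hd : ℓ₂ ∣ n₁
      · rw [if_pos hd]
        have hY' : ∀ ℓ₁, Y ℓ₁ ℓ₂ = (Nat.gcd (Int.natAbs ((ℓ₁ : ℤ) - ℓ₂)) (b * n₁) : ℝ) * E := by
          intro ℓ₁; simp only [hYdef, if_pos hd]
        simp_rw [hY']
        rw [← Finset.sum_filter, ← Finset.sum_mul]
        have hfc : 𝓛.filter (fun ℓ₁ => ℓ₂ ≠ ℓ₁) = 𝓛.filter (fun ℓ₁ : ℕ => ℓ₁ ≠ ℓ₂) :=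
          Finset.filter_congr fun _ _ => ne_comm
        rw [hfc]
        exact mul_le_mul_of_nonneg_right (kfd_sum_gcd_primes_le 𝓛 h𝓛' (h𝓛' ℓ₂ hℓ₂) hbn₁) hE0
      · rw [if_neg hd]
        refine le_of_eq (Finset.sum_eq_zero fun ℓ₁ _ => ?_)
        simp only [hYdef, if_neg hd]
        split_ifs <;> rfl
    refine (Finset.sum_le_sum hinner).trans (le_of_eq ?_)
    rw [← Finset.sum_filter, Finset.sum_const, nsmul_eq_mul, mul_comm]
  -- the number of amplifier primes dividing `n₁`
  have hcardlog : ((𝓛.filter (fun ℓ => ℓ ∣ n₁)).card : ℝ) ≤ Real.log (2 * N') / Real.log L := by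
    have hLr : (1 : ℝ) ≤ (L : ℝ) := by exact_mod_cast hL1
    have h := DFI_card_primes_dvd_mul_log_le (𝓛 := 𝓛) (L := (L : ℝ)) hLr
      (fun ℓ hℓ => ⟨(h𝓛 ℓ hℓ).1, by exact_mod_cast (h𝓛 ℓ hℓ).2.1⟩) hn₁pos
    have hlogL : 0 < Real.log L := Real.log_pos (by exact_mod_cast (lt_of_lt_of_le (by norm_num) hL : 1 < L))
    rw [le_div_iff₀ hlogL]
    refine h.trans ?_
    exact Real.log_le_log (by exact_mod_cast hn₁pos) hn₁2
  have hlogratio : 0 ≤ Real.log (2 * N') / Real.log L :=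
    le_trans (Nat.cast_nonneg _) hcardlog
  -- assemble
  have htotal : ∑ ℓ₁ ∈ 𝓛, ∑ ℓ₂ ∈ 𝓛, X ℓ₁ ℓ₂ =
      𝓛.card * len + ∑ ℓ₁ ∈ 𝓛, ∑ ℓ₂ ∈ 𝓛.filter (fun ℓ₂ => ℓ₂ ≠ ℓ₁), X ℓ₁ ℓ₂ := by
    rw [Finset.sum_congr rfl hsplit, Finset.sum_add_distrib, Finset.sum_const, nsmul_eq_mul]
  show ∑ ℓ₁ ∈ 𝓛, ∑ ℓ₂ ∈ 𝓛, X ℓ₁ ℓ₂ ≤ _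
  rw [htotal]
  have hoff : ∑ ℓ₁ ∈ 𝓛, ∑ ℓ₂ ∈ 𝓛.filter (fun ℓ₂ => ℓ₂ ≠ ℓ₁), X ℓ₁ ℓ₂ ≤
      Real.log (2 * N') / Real.log L * (4 * L * T * E) := by
    calc ∑ ℓ₁ ∈ 𝓛, ∑ ℓ₂ ∈ 𝓛.filter (fun ℓ₂ => ℓ₂ ≠ ℓ₁), X ℓ₁ ℓ₂
        ≤ ∑ ℓ₁ ∈ 𝓛, ∑ ℓ₂ ∈ 𝓛.filter (fun ℓ₂ => ℓ₂ ≠ ℓ₁), Y ℓ₁ ℓ₂ :=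
          Finset.sum_le_sum fun ℓ₁ hℓ₁ => Finset.sum_le_sum fun ℓ₂ hℓ₂ => hXY ℓ₁ hℓ₁ ℓ₂ hℓ₂
      _ ≤ (4 * L * (b * n₁).divisors.card * E) * ((𝓛.filter (fun ℓ => ℓ ∣ n₁)).card : ℝ) :=
          hYsum
      _ ≤ (4 * L * T * E) * (Real.log (2 * N') / Real.log L) := by gcongr
      _ = Real.log (2 * N') / Real.log L * (4 * L * T * E) := by ring
  have halg : 4 * (L : ℝ) * T * E = 4 * T * len / (b * N') +
      16 * T ^ 2 * L * Real.sqrt (b * L * N') * (1 + Real.log (4 * (b * L * N'))) := by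
    rw [hE]
    field_simp
    ring
  rw [halg] at hoff
  linarith

end Phi

include he in
/-- **The diagonal terms `𝓓_b`** (Bettin–Chandee §3, (eqn:diagonal) with `A = 1`, explicit
constants).  Let `b ≥ 1`, `(k, b) = 1`, `𝓛` a set of primes in `(L, 2L]` (`L ≥ 2`) not dividing
`k`, and `γ` supported on `N' < n` with `(n, k) = 1` and `τ(bn) ≤ T`.  Then for `M₁ ≤ M₂`,
writing `c_m(n) = γ_n e(k m̄/(bn))`,
`‖∑_{M₁<m≤M₂,(m,b)=1} ∑_{ℓ₁,ℓ₂∈𝓛, n₁,n₂≤2N', ℓ₁n₁=ℓ₂n₂, (ℓ₂n₂,m)=1, ℓ₁n₁≡ℓ₂n₂ (m)} c_m(n₁) conj c_m(n₂)‖`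
`≤ ‖γ‖² ( #𝓛 (M₂-M₁) + (log(2N')/log L) (4T(M₂-M₁)/(bN') + 16 T² L (bLN')^{1/2} (1+log(4bLN'))) )`,
i.e. `𝓓_b ≪ ‖γ‖² (LM + M/(bN') + L(bLN')^{1/2}) (MN)^ε`: the terms `ℓ₁ = ℓ₂` trivially, the
terms `ℓ₁ ≠ ℓ₂` by the completed Weil bound for the `m`-sum to modulus `bℓ₁n₁` and frequency
`k(ℓ₁ - ℓ₂) ≠ 0`.  (The left side is `‖∑_m kfDiag k b N' γ 𝓛 m‖` of
`KloostermanFractionsAmplifiedForm.lean`, unfolded.) [cite: BettinChandee2018, §3 (eqn:diagonal)] -/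
theorem kfd_diag_bound (k : ℤ) {b L : ℕ} (hb : 0 < b) (hL : 2 ≤ L) (hkb : k.natAbs.Coprime b)
    (𝓛 : Finset ℕ) (h𝓛 : ∀ ℓ ∈ 𝓛, ℓ.Prime ∧ L < ℓ ∧ ℓ ≤ 2 * L ∧ ℓ.Coprime k.natAbs)
    {N' T : ℝ} (hN' : 0 < N') (γ : ℕ → ℂ)
    (hγ : ∀ n, γ n ≠ 0 → N' < n ∧ n.Coprime k.natAbs ∧ ((b * n).divisors.card : ℝ) ≤ T)
    {M₁ M₂ : ℕ} (hM : M₁ ≤ M₂) :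
    ‖∑ m ∈ (Ioc M₁ M₂).filter (fun m => m.Coprime b),
        ∑ ℓ₁ ∈ 𝓛, ∑ n₁ ∈ Icc 1 ⌊2 * N'⌋₊, ∑ ℓ₂ ∈ 𝓛, ∑ n₂ ∈ Icc 1 ⌊2 * N'⌋₊,
          (if ℓ₁ * n₁ = ℓ₂ * n₂ then
            (if (ℓ₂ * n₂).Coprime m ∧ ((ℓ₁ * n₁ : ℕ) : ZMod m) = ((ℓ₂ * n₂ : ℕ) : ZMod m) then
              γ n₁ * e k (b * n₁) m * (starRingEnd ℂ) (γ n₂ * e k (b * n₂) m) else 0)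
          else 0)‖ ≤
      (∑ n ∈ Icc 1 ⌊2 * N'⌋₊, ‖γ n‖ ^ 2) *
        (𝓛.card * ((M₂ : ℝ) - M₁) + Real.log (2 * N') / Real.log L *
          (4 * T * ((M₂ : ℝ) - M₁) / (b * N') +
            16 * T ^ 2 * L * Real.sqrt (b * L * N') * (1 + Real.log (4 * (b * L * N'))))) := by
  -- the weight `Φ` of the intermediate lemmas, as an opaque function
  obtain ⟨Φ, hΦ⟩ : ∃ Φ : ℤ → ℕ → ℕ → ℕ → ℕ → ℕ → ℕ → ℝ,
      ∀ (k : ℤ) (b M₁ M₂ ℓ₁ ℓ₂ N₀ : ℕ), Φ k b M₁ M₂ ℓ₁ ℓ₂ N₀ =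
        if ℓ₁ = ℓ₂ then ((M₂ : ℝ) - (M₁ : ℝ)) else
          (((M₂ : ℝ) - (M₁ : ℝ)) / ((b * N₀ : ℕ) : ℝ) *
              (Int.gcd (k * ((ℓ₁ : ℤ) - (ℓ₂ : ℤ))) ((b * N₀ : ℕ) : ℤ) : ℝ) +
            ((Nat.divisors (b * N₀)).card : ℝ) * Real.sqrt ((b * N₀ : ℕ) : ℝ) *
              Real.sqrt (Int.gcd (k * ((ℓ₁ : ℤ) - (ℓ₂ : ℤ))) ((b * N₀ : ℕ) : ℤ) : ℝ) *
              (1 + Real.log ((b * N₀ : ℕ) : ℝ))) :=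
    ⟨fun k b M₁ M₂ ℓ₁ ℓ₂ N₀ =>
        if ℓ₁ = ℓ₂ then ((M₂ : ℝ) - (M₁ : ℝ)) else
          (((M₂ : ℝ) - (M₁ : ℝ)) / ((b * N₀ : ℕ) : ℝ) *
              (Int.gcd (k * ((ℓ₁ : ℤ) - (ℓ₂ : ℤ))) ((b * N₀ : ℕ) : ℤ) : ℝ) +
            ((Nat.divisors (b * N₀)).card : ℝ) * Real.sqrt ((b * N₀ : ℕ) : ℝ) *
              Real.sqrt (Int.gcd (k * ((ℓ₁ : ℤ) - (ℓ₂ : ℤ))) ((b * N₀ : ℕ) : ℤ) : ℝ) *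
              (1 + Real.log ((b * N₀ : ℕ) : ℝ))),
      fun _ _ _ _ _ _ _ => rfl⟩
  have h1 := kfd_diag_norm_le_weighted e he Φ hΦ k hb γ 𝓛 (fun ℓ hℓ => (h𝓛 ℓ hℓ).1.pos)
    (Icc 1 ⌊2 * N'⌋₊) (fun n hn => (Finset.mem_Icc.mp hn).1) hM
  refine h1.trans ?_
  rw [Finset.sum_comm]
  have hpull : ∀ n₁ ∈ Icc 1 ⌊2 * N'⌋₊,
      ∑ ℓ₁ ∈ 𝓛, ‖γ n₁‖ ^ 2 *
        ∑ ℓ₂ ∈ 𝓛, (if ℓ₂ ∣ ℓ₁ * n₁ then Φ k b M₁ M₂ ℓ₁ ℓ₂ (ℓ₁ * n₁) else 0) =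
      ‖γ n₁‖ ^ 2 * ∑ ℓ₁ ∈ 𝓛, ∑ ℓ₂ ∈ 𝓛,
        (if ℓ₂ ∣ ℓ₁ * n₁ then Φ k b M₁ M₂ ℓ₁ ℓ₂ (ℓ₁ * n₁) else 0) := by
    intro n₁ _; rw [Finset.mul_sum]
  rw [Finset.sum_congr rfl hpull, Finset.sum_mul]
  refine Finset.sum_le_sum fun n₁ hn₁ => ?_
  by_cases hγ0 : γ n₁ = 0
  · simp [hγ0]
  · obtain ⟨hN, hk, hτ⟩ := hγ n₁ hγ0
    have hn2 : (n₁ : ℝ) ≤ 2 * N' := by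
      have h := (Finset.mem_Icc.mp hn₁).2
      calc (n₁ : ℝ) ≤ ⌊2 * N'⌋₊ := by exact_mod_cast h
        _ ≤ 2 * N' := Nat.floor_le (by positivity)
    exact mul_le_mul_of_nonneg_left
      (kfd_inner_primes_le Φ hΦ k hb hL hkb 𝓛 h𝓛 hN' hN hn2 hk hτ hM) (sq_nonneg _)

end Phase

end Literature.NumberTheory.LFunctions

end
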